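import Literature.IUT.LogVolume.PacketVolume
import Summits.ABC.IUTFork.LanaRealHull
import HarnessLib

/-!
# L-LANA checks: the real-container `η`-datum is INHABITED over `ℚ_p`, and (9-1) is satisfiable AND refutable there (vacuity audit of `RealHullInput`)

Record-only check file (D-0012) of the abc-iut cell (seat abc-iut-c312-4, L-LANA level; vacuity audit of the
gen-2 structure `RealHullInput` of `LanaRealHull.lean`, in the spirit of LANA Rem. 8.2.1 and of gen-0's
`LanaRssChecks` / `LanaWitnesses`); TAKES NO SIDE on [IUTchIII] Cor. 3.12. Over the REAL container `ℚ_p`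
(one direct summand: `J = Unit`, `K _ = ℚ_p`, integral structure `O_L = ℤ_p` = S2's `piUnitBallStructure`,
normalised Haar measure), the input structure is inhabited WITHOUT any hypothesis beyond a Borel structure on
`ℚ_p`: `q := p`, the possible images `⋃_λ U_λ := p·ℤ_p` (a hull-set: bounded, nondegenerate), the output map
`S ↦ S`, and ONE suitable `S` = the region `p·ℤ_p` itself (`padicInput`). For this witness LANA's main goal
(9-1) HOLDS (`padicInput_mainGoal`: the `q`-region and the output region coincide); with NO suitable `S` it
FAILS (`padicInputEmpty_not_mainGoal`). So, exactly as at the abstract level (gen 0), over real Haar measure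
(9-1) is neither automatic nor impossible: it is a statement about WHICH `S` are suitable — the content of
(Ind1)–(Ind3) / Thm. 3.11, which this cell types but does not assert.
[cite: LANA2026Report, Rem. 8.2.1 p. 42, §9.2 (9-1) p. 46, §10.4 p. 49] NOT here: any judgement.
-/

noncomputable section

open MeasureTheory Set Metric Bornology
open Literature.IUT.LogVolume

namespace Summit.ABC
namespace IUTFork

namespace RealHullChecks

variable (p : ℕ) [Fact p.Prime] [MeasurableSpace ℚ_[p]] [BorelSpace ℚ_[p]]

/-- The one-summand container `ℚ_p` (index `J = Unit`). [folklore] -/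
abbrev summand : Unit → Type := fun _ => ℚ_[p]

/-- Its integral structure `O_L = ℤ_p` (S2's `piUnitBallStructure`). [folklore] -/
abbrev intStructure : IntegralStructure (Π _ : Unit, ℚ_[p]) := piUnitBallStructure (summand p)

/-- The element `q := p` in each (the single) summand. [folklore] -/
def qElt : Π _ : Unit, ℚ_[p] := fun _ => (p : ℚ_[p])

omit [MeasurableSpace ℚ_[p]] [BorelSpace ℚ_[p]] in
/-- `p ≠ 0` in `ℚ_p`. [folklore] -/
theorem qElt_ne (j : Unit) : qElt p j ≠ 0 := by
  change (p : ℚ_[p]) ≠ 0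
  exact_mod_cast (Fact.out : p.Prime).ne_zero

/-- The region `p·ℤ_p` (a hull-set region of `LanaRealHull`). [folklore] -/
def pRegion : Region (intStructure p).haar := hullSetRegion (summand p) (intStructure p) (qElt p) (qElt_ne p)

/-- **A `RealHullInput` over `ℚ_p`** (non-vacuity of the gen-2 input structure): `ℝ^val` the log-volume line
pointed by `1`, `q := p`, output map `S ↦ S`, the single suitable `S := p·ℤ_p`, possible images `p·ℤ_p`.
[cite: LANA2026Report, §9.2 p. 46] -/
def padicInput : RealHullInput (summand p) (intStructure p) where
  Rval := volLine 1 one_ne_zero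
  q := qElt p
  q_ne := qElt_ne p
  LGP S := S
  Suitable := {pRegion p}
  images := hullSet (summand p) (qElt p)
  images_bounded := isBounded_hullSet (summand p) (qElt p)
  images_nondegenerate := IsHullSet.isNondegenerate (summand p) ⟨qElt p, qElt_ne p, rfl⟩
  lgp_subset S hS := by
    rw [Set.mem_singleton_iff] at hS
    subst hS
    exact subset_rfl

/-- For the witness, **(9-1) HOLDS**: the `q`-region `p·ℤ_p` IS the output region `LGP·S = S = p·ℤ_p` of the
suitable `S` (equal regions, equal classes in `ℝ^ss`). [cite: LANA2026Report, §9.2 (9-1) p. 46] -/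
theorem padicInput_mainGoal : (padicInput p).etaData.MainGoal :=
  ⟨pRegion p, Set.mem_singleton _, rfl⟩

/-- … hence (8-1) for the witness, by the general theorem (no inclusion hypothesis: the hull is real).
[cite: LANA2026Report, §8.1 (8-1) p. 41] -/
theorem padicInput_cor312 :
    (intStructure p).logVolume (hullSet (summand p) (qElt p)) ≤ (intStructure p).logVolume (holomorphicHull (summand p) (hullSet (summand p) (qElt p))) :=
  (padicInput p).cor312_of_mainGoal (padicInput_mainGoal p)

/-- The same data with NO suitable `S` ((Ind3) granting nothing). [cite: LANA2026Report, §10.4 p. 49] -/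
def padicInputEmpty : RealHullInput (summand p) (intStructure p) where
  Rval := volLine 1 one_ne_zero
  q := qElt p
  q_ne := qElt_ne p
  LGP S := S
  Suitable := ∅
  images := hullSet (summand p) (qElt p)
  images_bounded := isBounded_hullSet (summand p) (qElt p)
  images_nondegenerate := IsHullSet.isNondegenerate (summand p) ⟨qElt p, qElt_ne p, rfl⟩
  lgp_subset S hS := absurd hS (Set.notMem_empty S)

/-- For that input, **(9-1) FAILS** — over real Haar measure (9-1) is not automatic either.
[cite: LANA2026Report, Rem. 8.2.1 p. 42] -/
theorem padicInputEmpty_not_mainGoal : ¬ (padicInputEmpty p).etaData.MainGoal :=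
  (padicInputEmpty p).not_mainGoal_of_suitable_empty rfl

/-- Both inputs have the SAME `q`-region and the SAME real hull: what decides (9-1) is only the family of
suitable `S`. [cite: LANA2026Report, §10.4 p. 49] -/
theorem hulls_agree :
    (padicInput p).etaData.hull.carrier = (padicInputEmpty p).etaData.hull.carrier ∧
      (padicInput p).etaData.qRegion.carrier = (padicInputEmpty p).etaData.qRegion.carrier :=
  ⟨rfl, rfl⟩

end RealHullChecks

end IUTFork

end Summit.ABC

end
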